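import Mathlib
import Literature.NumberTheory.Sieve.ParityBatemanHorn

/-!
# Sketch — crux-ideate stmt-Parity-11292 (SystemLSDRealSegment), ideator 3, round 1

First lemmas of the three idea cards, stated over existing declarations
(`Literature.NumberTheory.Sieve.IsBatemanHornSystem`, `…batemanHornConst`, Mathlib).
They are STATEMENTS (Props); nothing is proved here.  `k = 1` (a single polynomial of degree `g`)
is the first instance in each case; the cards explain the system version.
-/

namespace Summit.Parity.BatemanHorn.Cruxes.SystemLSDRealSegment.Ideator3Sketch

open scoped BigOperators Classical
open Filter

/-- The capped almost-prime statistic `s(m) = Σ_{p^v ∥ m} min(v,2)` (as in the route file). -/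
noncomputable def cappedOmega (m : ℕ) : ℕ := m.factorization.sum fun _ v => min v 2

/-- The Möbius transform `h_y` of `m ↦ y^{s(m)}`: multiplicative, `h_y(p) = y − 1`,
`h_y(p²) = y² − y`, `h_y(p^v) = 0` for `v ≥ 3`; so `y^{s(m)} = Σ_{d ∣ m} h_y(d)` and `h_y ≥ 0` for
`y ≥ 1`. -/
noncomputable def thinWeight (y : ℂ) (d : ℕ) : ℂ :=
  d.factorization.prod fun _ v => if v = 1 then y - 1 else if v = 2 then y ^ 2 - y else 0

/-- `A_d(x) = #{0 ≤ n ≤ x : d ∣ f(n)}` (the Type-I datum of the polynomial sequence). -/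
noncomputable def divCount (f : Polynomial ℤ) (d x : ℕ) : ℕ :=
  ((Finset.range (x + 1)).filter fun n : ℕ => (d : ℤ) ∣ f.eval (n : ℤ)).card

/-- CARD 1 (`beta-thinned-root-kernel`), First lemma **TypeIPart** (k = 1): the level-`x` part of
the divisor expansion of `Σ_{n ≤ x} y^{s(f(n))}` obeys a Landau–Selberg–Delange law ON THE
INTEGERS with an entire Euler factor `Λ = λ_f`, `Λ(0) = C(f)`, `Λ(1) = 1`:
`x⁻¹ (log x)^{1−y} Σ_{d ≤ x} h_y(d) A_d(x) → Λ(y)/Γ(y)` for every real `y > 1`.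
(Provable from LSD for the Frobenian function `d ↦ h_y(d) ρ_f(d)` + the prime ideal theorem.) -/
def TypeIPart : Prop :=
  ∀ f : Polynomial ℤ, Literature.NumberTheory.Sieve.IsBatemanHornSystem ![f] →
    ∃ Λ : ℂ → ℂ, Differentiable ℂ Λ ∧
      Λ 0 = (Literature.NumberTheory.Sieve.batemanHornConst ![f] : ℂ) ∧ Λ 1 = 1 ∧
      ∀ y : ℝ, 1 < y →
        Tendsto (fun x : ℕ => (x : ℂ)⁻¹ * Complex.exp ((1 - (y : ℂ)) * (Real.log (Real.log x) : ℂ)) *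
            ∑ d ∈ Finset.Icc 1 x, thinWeight y d * (divCount f d x : ℂ))
          atTop (nhds (Λ y * (Complex.Gamma y)⁻¹))

/-- CARD 1, the KERNEL it isolates (k = 1, degree `g = natDegree f`): the beyond-level mass has the
Beta(y−1,1)-complement constant, `x⁻¹(log x)^{1−y} Σ_{x < d} h_y(d) A_d(x) → Λ(y)(g^{y−1} − 1)/Γ(y)`
with the SAME `Λ` (stated jointly with the Type-I part so that `Λ` is shared). Open for `g ≥ 2`. -/
def BetaKernel : Prop :=
  ∀ f : Polynomial ℤ, Literature.NumberTheory.Sieve.IsBatemanHornSystem ![f] →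
    ∃ Λ : ℂ → ℂ, Differentiable ℂ Λ ∧
      Λ 0 = (Literature.NumberTheory.Sieve.batemanHornConst ![f] : ℂ) ∧ Λ 1 = 1 ∧
      ∀ y : ℝ, 1 < y →
        Tendsto (fun x : ℕ => (x : ℂ)⁻¹ * Complex.exp ((1 - (y : ℂ)) * (Real.log (Real.log x) : ℂ)) *
            ∑ d ∈ Finset.Icc 1 x, thinWeight y d * (divCount f d x : ℂ))
          atTop (nhds (Λ y * (Complex.Gamma y)⁻¹)) ∧
        Tendsto (fun x : ℕ => (x : ℂ)⁻¹ * Complex.exp ((1 - (y : ℂ)) * (Real.log (Real.log x) : ℂ)) *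
            ∑ d ∈ Finset.Ioc x (x ^ f.natDegree * (f.leadingCoeff.toNat + 1) + 1),
              thinWeight y d * (divCount f d x : ℂ))
          atTop (nhds (Λ y * (Complex.exp (((y : ℂ) - 1) * (Real.log (f.natDegree : ℝ) : ℂ)) - 1) *
            (Complex.Gamma y)⁻¹))

/-- CARD 2 (`ewens-pd-kernel`), First lemma **DickmanInProgressions** (r = 1 of the y-free
Poisson–Dirichlet kernel, k = 1, degree `g`): for a fixed modulus `q` and class `a`, and
`g/2 ≤ u < g`, the proportion of `n ≤ x`, `n ≡ a (mod q)`, for which `f(n)` has a prime factor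
`> x^u` tends to `log (g/u)` (Dickman's `1 − ρ(t) = log t` on `[1,2]`). Open for `g ≥ 2` (q = 1 is
the density of `n` with `P⁺(n²+1) > n^{u}`). -/
noncomputable def DickmanInProgressions : Prop :=
  ∀ f : Polynomial ℤ, Literature.NumberTheory.Sieve.IsBatemanHornSystem ![f] →
    ∀ q a : ℕ, 0 < q → ∀ u : ℝ, (f.natDegree : ℝ) / 2 ≤ u → u < f.natDegree →
      Tendsto (fun x : ℕ => (q : ℝ) / x *
          (((Finset.range (x + 1)).filter fun n : ℕ =>
              n % q = a % q ∧ ∃ p : ℕ, p.Prime ∧ (x : ℝ) ^ u < p ∧ (p : ℤ) ∣ f.eval (n : ℤ)).card : ℝ))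
        atTop (nhds (Real.log ((f.natDegree : ℝ) / u)))

/-- CARD 3 (`tilt-flow-dickman-anchor`), First lemma **TiltedLargestPrime** (k = 1, degree `g`):
under the `y^{s(f(n))}`-tilted measure the probability that `f(n)` has a prime factor `> x`
tends to the PD(y) tail `β_g(y) = ∫_{1/g}^{1} y v⁻¹ (1−v)^{y−1} dv` (`= log g` at `y = 1`), for
every real `y ∈ [1, 7/4)`.  It is `y · d/dy` of the crux's `log`-normalised law minus its Type-I
part; open for `g ≥ 2`. -/
noncomputable def TiltedLargestPrime : Prop :=
  ∀ f : Polynomial ℤ, Literature.NumberTheory.Sieve.IsBatemanHornSystem ![f] →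
    ∀ y : ℝ, 1 ≤ y → y < 7 / 4 →
      Tendsto (fun x : ℕ =>
          (∑ n ∈ (Finset.range (x + 1)).filter
              (fun n : ℕ => ∃ p : ℕ, p.Prime ∧ x < p ∧ (p : ℤ) ∣ f.eval (n : ℤ)),
            y ^ cappedOmega (f.eval (n : ℤ)).toNat) /
          (∑ n ∈ Finset.range (x + 1), y ^ cappedOmega (f.eval (n : ℤ)).toNat))
        atTop (nhds (∫ v in Set.Ioo (1 / (f.natDegree : ℝ)) 1, y * v⁻¹ * (1 - v) ^ (y - 1)))

end Summit.Parity.BatemanHorn.Cruxes.SystemLSDRealSegment.Ideator3Sketch
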